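import Summits.HubbardSuperconductivity.HubbardSuperconductivity.Theorems.KLProgrammeKLRegimeSplitFrameFn
import Summits.HubbardSuperconductivity.HubbardSuperconductivity.Theorems.KLProgrammeKLRegimeSplitEvalDerivBounds
import Summits.HubbardSuperconductivity.HubbardSuperconductivity.Theorems.KLProgrammeKLRegimeSplitFermiPointSmooth
import Summits.HubbardSuperconductivity.HubbardSuperconductivity.Theorems.KLProgrammePerturbedFermiCurveDefs

/-!
# The lattice-invisible frame `ε (h_{L,0} − h_{0,0})` and the scale-`0` two-leg pieces at the tube point `(2π/3, 0)`

Helper file (refuter lane, `Negative/`) for the negative lemma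
`KLRegimeEngineV14_false_of_ScaleZeroSelfEnergyRadialLipschitz` (sibling file): the `C₄ᵥ` trigonometric polynomial
`K' = ε (h_{L,0} − h_{0,0})` (the structure literal `⟨L, fun m n => if m = L ∧ n = 0 then ε else if m = 0 ∧ n = 0 then -ε else 0⟩`;
every lemma takes `K` with `hK : K = ⟨L, …⟩` — a proof-only file, no definitions), `K'(p) = ε((cos(L p₀) + cos(L p₁))/2 − 1)`, which

* vanishes at every momentum of the `L × L` lattice (`toTrigPoly L K'.eval = toTrigPoly L 0`: the finite-volume model with
  frame `K'` IS the bare model),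
* is uniformly small (`|K'| ≤ 2ε`, `‖Dʲ K'‖ ≤ ((1+L)ʲ + 1)ε`) and hence an ADMISSIBLE frame (`FrameOK R U N μ K'`) at every
  number of scales `N` as soon as `2(1+L)⁴ε ≤ U² ≤ U ≤ 1`, `2(1+L)²ε ≤ 1/2000`, `R.Gfr ≥ 1`,
* but does not vanish between lattice points: on the ray `θ = 0`, `K'(r·dir 0) = ε(cos(L r) − 1)/2`.

Plus the evaluation of the scale-`0` function-carrier two-leg piece `klTwoLegPieceFn … K 0` at `q⋆ = (2π/3, 0)` (flat cutoff `1`,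
polar angle `0`): `ℓ_0(K)(q⋆) = ν_0(K)(u_K(0)·dir 0) − K(u_K(0)·dir 0)`, the free Fermi radius `u_0(0) = 2π/3` of `μ = -1`, the
admissibility of the zero frame on the covariance window, and the order-zero Fermi-radius shift `|u_{K'}(0) − 2π/3| ≤ 2ε/Dt_min`.
-/

noncomputable section

set_option linter.dupNamespace false

namespace Summit.HubbardSuperconductivity.HubbardSuperconductivity.Theorems.KLRegimeEngineV14.Negative

open Real Finset Literature.MathematicalPhysics.QuantumLattice Literature.Probability.LatticeModels
open Literature.MathematicalPhysics.QuantumLattice.FermiRG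
open Literature.MathematicalPhysics.QuantumLattice.BandSectorCounting
open Summit.HubbardSuperconductivity.HubbardSuperconductivity.Theorems.KLRegimeSplit
open Summit.HubbardSuperconductivity.HubbardSuperconductivity.Theorems.DispersionFlow
open Summit.HubbardSuperconductivity.HubbardSuperconductivity.Theorems.PerturbedFermiCurve
open Summit.HubbardSuperconductivity.HubbardSuperconductivity.Theorems.KLProgrammeLegKernels

/-! ## §1 The lattice-invisible frame `K' = ε (h_{L,0} − h_{0,0})` -/

/-! The witness frame is the structure literal `⟨L, fun m n => if m = L ∧ n = 0 then ε else if m = 0 ∧ n = 0 then -ε else 0⟩`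
(degree `L`, coefficient `ε` on the harmonic `h_{L,0}` and `−ε` on the constant `h_{0,0}`); every lemma below takes a frame `K`
together with the hypothesis `hK : K = ⟨L, …⟩`, so that this proof-only file declares no definition. -/

/-- A double sum over `range (L+1)²` of a table supported on `{(L,0), (0,0)}` (`L ≠ 0`). -/
private theorem sum_sum_collapse {L : ℕ} (hL : L ≠ 0) (f : ℕ → ℕ → ℝ)
    (hf : ∀ m n, (m ≠ L ∨ n ≠ 0) → (m ≠ 0 ∨ n ≠ 0) → f m n = 0) :
    ∑ m ∈ range (L + 1), ∑ n ∈ range (L + 1), f m n = f L 0 + f 0 0 := by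
  have inner : ∀ m, ∑ n ∈ range (L + 1), f m n = f m 0 := by
    intro m
    rw [Finset.sum_eq_single 0 (fun n _ hn => hf m n (Or.inr hn) (Or.inr hn)) (fun h => (h (by simp)).elim)]
  simp_rw [inner]
  exact Finset.sum_eq_add L 0 hL (fun m _ hm => hf m 0 (Or.inl hm.1) (Or.inl hm.2)) (fun h => (h (by simp)).elim)
    (fun h => (h (by simp)).elim)

/-- The degree is `L`. -/
theorem invisibleFrame_degree {L : ℕ} {ε : ℝ} {K : TrigPolyC4v} (hK : K = ⟨L, fun m n => if m = L ∧ n = 0 then ε else if m = 0 ∧ n = 0 then -ε else 0⟩) : K.degree = L := by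
  subst hK; rfl

/-- The coefficient of `h_{L,0}` is `ε`. -/
theorem invisibleFrame_coeff_L0 {L : ℕ} {ε : ℝ} {K : TrigPolyC4v} (hK : K = ⟨L, fun m n => if m = L ∧ n = 0 then ε else if m = 0 ∧ n = 0 then -ε else 0⟩) : K.coeff L 0 = ε := by
  subst hK; simp

/-- The coefficient of `h_{0,0}` is `−ε` (`L ≠ 0`). -/
theorem invisibleFrame_coeff_00 {L : ℕ} (hL : L ≠ 0) {ε : ℝ} {K : TrigPolyC4v} (hK : K = ⟨L, fun m n => if m = L ∧ n = 0 then ε else if m = 0 ∧ n = 0 then -ε else 0⟩) :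
    K.coeff 0 0 = -ε := by
  subst hK; simp [hL.symm]

/-- All other coefficients vanish. -/
theorem invisibleFrame_coeff_off {L : ℕ} {ε : ℝ} {K : TrigPolyC4v} (hK : K = ⟨L, fun m n => if m = L ∧ n = 0 then ε else if m = 0 ∧ n = 0 then -ε else 0⟩)
    {m n : ℕ} (h1 : m ≠ L ∨ n ≠ 0) (h2 : m ≠ 0 ∨ n ≠ 0) : K.coeff m n = 0 := by
  subst hK
  dsimp only
  split_ifs with ha hb
  · exfalso; omega
  · exfalso; omega
  · rfl

/-- **Closed form**: `K'(p) = ε((cos(L p₀) + cos(L p₁))/2 − 1)`. -/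
theorem invisibleFrame_eval {L : ℕ} (hL : L ≠ 0) {ε : ℝ} {K : TrigPolyC4v} (hK : K = ⟨L, fun m n => if m = L ∧ n = 0 then ε else if m = 0 ∧ n = 0 then -ε else 0⟩)
    (p : Fin 2 → ℝ) : K.eval p = ε * ((Real.cos (L * p 0) + Real.cos (L * p 1)) / 2 - 1) := by
  rw [TrigPolyC4v.eval_def, invisibleFrame_degree hK, sum_sum_collapse hL
    (fun m n => K.coeff m n * TrigPolyC4v.harmonic m n p)
    (fun m n h1 h2 => by rw [invisibleFrame_coeff_off hK h1 h2, zero_mul])]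
  rw [invisibleFrame_coeff_L0 hK, invisibleFrame_coeff_00 hL hK, TrigPolyC4v.harmonic_zero_zero]
  simp [TrigPolyC4v.harmonic]
  ring

/-- **Coefficient weights**: `coeffNorm j K' = ((1+L)^j + 1)·ε` for `ε ≥ 0`. -/
theorem invisibleFrame_coeffNorm {L : ℕ} (hL : L ≠ 0) {ε : ℝ} (hε : 0 ≤ ε) {K : TrigPolyC4v} (hK : K = ⟨L, fun m n => if m = L ∧ n = 0 then ε else if m = 0 ∧ n = 0 then -ε else 0⟩)
    (j : ℕ) : K.coeffNorm j = ((1 + (L : ℝ)) ^ j + 1) * ε := by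
  unfold TrigPolyC4v.coeffNorm
  rw [invisibleFrame_degree hK, sum_sum_collapse hL (fun m n => (1 + m + n : ℝ) ^ j * |K.coeff m n|)
    (fun m n h1 h2 => by rw [invisibleFrame_coeff_off hK h1 h2, abs_zero, mul_zero])]
  rw [invisibleFrame_coeff_L0 hK, invisibleFrame_coeff_00 hL hK, abs_neg, abs_of_nonneg hε]
  push_cast
  ring

/-- `−2ε ≤ K'(p) ≤ 0` hence `|K'(p)| ≤ 2ε` (`ε ≥ 0`). -/
theorem abs_invisibleFrame_eval_le {L : ℕ} (hL : L ≠ 0) {ε : ℝ} (hε : 0 ≤ ε) {K : TrigPolyC4v} (hK : K = ⟨L, fun m n => if m = L ∧ n = 0 then ε else if m = 0 ∧ n = 0 then -ε else 0⟩)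
    (p : Fin 2 → ℝ) : |K.eval p| ≤ 2 * ε := by
  rw [invisibleFrame_eval hL hK]
  have h0 := Real.neg_one_le_cos (L * p 0)
  have h1 := Real.neg_one_le_cos (L * p 1)
  have h0' := Real.cos_le_one (L * p 0)
  have h1' := Real.cos_le_one (L * p 1)
  rw [abs_le]
  constructor <;> nlinarith

/-- **Lattice invisibility**: `K'` vanishes at every lattice momentum `2πk/L`. -/
theorem invisibleFrame_eval_latticeMomentum {L : ℕ} [NeZero L] {ε : ℝ} {K : TrigPolyC4v} (hK : K = ⟨L, fun m n => if m = L ∧ n = 0 then ε else if m = 0 ∧ n = 0 then -ε else 0⟩)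
    (k : TorusSite 2 L) : K.eval (latticeMomentum L k) = 0 := by
  rw [invisibleFrame_eval (NeZero.ne L) hK]
  have hL : (L : ℝ) ≠ 0 := by exact_mod_cast NeZero.ne L
  have h : ∀ i, Real.cos (L * latticeMomentum L k i) = 1 := by
    intro i
    have : (L : ℝ) * latticeMomentum L k i = ((k i).val : ℕ) * (2 * π) := by
      simp only [latticeMomentum]
      field_simp
    rw [this, Real.cos_nat_mul_two_pi]
  rw [h 0, h 1]
  ring

/-- On the ray `θ = 0`: `K'(r·dir 0) = ε(cos(L r) − 1)/2`. -/
theorem invisibleFrame_eval_ray {L : ℕ} (hL : L ≠ 0) {ε : ℝ} {K : TrigPolyC4v} (hK : K = ⟨L, fun m n => if m = L ∧ n = 0 then ε else if m = 0 ∧ n = 0 then -ε else 0⟩) (r : ℝ) :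
    K.eval (r • dir 0) = ε * (Real.cos (L * r) - 1) / 2 := by
  rw [invisibleFrame_eval hL hK]
  simp only [Pi.smul_apply, smul_eq_mul, dir_zero, dir_one, Real.cos_zero, Real.sin_zero, mul_one, mul_zero,
    Real.cos_zero]
  ring

/-- The model does not see `K'`: `toTrigPoly L K'.eval = toTrigPoly L 0`. -/
theorem toTrigPoly_invisibleFrame {L : ℕ} [NeZero L] {ε : ℝ} {K : TrigPolyC4v} (hK : K = ⟨L, fun m n => if m = L ∧ n = 0 then ε else if m = 0 ∧ n = 0 then -ε else 0⟩) :
    toTrigPoly L K.eval = toTrigPoly L 0 := by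
  unfold toTrigPoly
  congr 1
  funext k
  rw [invisibleFrame_eval_latticeMomentum hK]
  rfl

/-- The zero frame read on `Momentum` is the zero function. -/
theorem evalM_zero_fun : evalM (0 : TrigPolyC4v) = fun _ : Momentum => (0 : ℝ) := by
  funext q; simp [evalM_apply, TrigPolyC4v.eval_zero]

/-- All derivatives of `K'` read on `Momentum`: `‖Dʲ K'‖ ≤ ((1+L)^j + 1)ε`. -/
theorem norm_iteratedFDeriv_invisibleFrame_le {L : ℕ} (hL : L ≠ 0) {ε : ℝ} (hε : 0 ≤ ε) {K : TrigPolyC4v}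
    (hK : K = ⟨L, fun m n => if m = L ∧ n = 0 then ε else if m = 0 ∧ n = 0 then -ε else 0⟩) (j : ℕ) (q : Momentum) :
    ‖iteratedFDeriv ℝ j (evalM K) q‖ ≤ ((1 + (L : ℝ)) ^ j + 1) * ε := by
  rw [← invisibleFrame_coeffNorm hL hε hK j]
  exact norm_iteratedFDeriv_evalM_le_coeffNorm _ j q

/-- The same for the frame shift `−K'`. -/
theorem norm_iteratedFDeriv_frameShift_invisibleFrame_le {L : ℕ} (hL : L ≠ 0) {ε : ℝ} (hε : 0 ≤ ε) {K : TrigPolyC4v}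
    (hK : K = ⟨L, fun m n => if m = L ∧ n = 0 then ε else if m = 0 ∧ n = 0 then -ε else 0⟩) (j : ℕ) (q : Momentum) :
    ‖iteratedFDeriv ℝ j (frameShift K) q‖ ≤ ((1 + (L : ℝ)) ^ j + 1) * ε := by
  have h : frameShift K = -evalM K := by
    funext q; simp [frameShift_eq_neg_evalM]
  rw [h, iteratedFDeriv_neg_apply, norm_neg]
  exact norm_iteratedFDeriv_invisibleFrame_le hL hε hK j q

/-- `((1+L)^j + 1)ε ≤ 2(1+L)^k ε` for `j ≤ k`. -/
private theorem weight_le {L : ℕ} {ε : ℝ} (hε : 0 ≤ ε) {j k : ℕ} (hjk : j ≤ k) :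
    ((1 + (L : ℝ)) ^ j + 1) * ε ≤ 2 * (1 + (L : ℝ)) ^ k * ε := by
  have h1 : (1 : ℝ) ≤ 1 + L := by have := (Nat.cast_nonneg L : (0 : ℝ) ≤ L); linarith
  have hj : (1 + (L : ℝ)) ^ j ≤ (1 + (L : ℝ)) ^ k := pow_le_pow_right₀ h1 hjk
  have hk : (1 : ℝ) ≤ (1 + (L : ℝ)) ^ k := one_le_pow₀ h1
  nlinarith

/-- **`K'` is an admissible frame** (`FrameOK R U N μ K'`) on the covariance window as soon as `2(1+L)⁴ε ≤ U² ≤ U ≤ 1`,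
`2(1+L)²ε ≤ 1/2000` and `R.Gfr j ≥ 1` — at EVERY `N`, in particular at every volume / number of scales. -/
theorem frameOK_invisibleFrame {L : ℕ} (hL : L ≠ 0) {ε U : ℝ} (hε : 0 < ε) (hU : 0 < U) (hU1 : U ≤ 1)
    (h4 : 2 * (1 + (L : ℝ)) ^ 4 * ε ≤ U ^ 2) (hA : 2 * (1 + (L : ℝ)) ^ 2 * ε ≤ 1 / 2000)
    {R : RenConsts} (hR : ∀ j, 1 ≤ R.Gfr j) {μ : ℝ} (hμ : μ ∈ Set.Icc (-1.05 : ℝ) (-0.15)) (N : ℕ) {K : TrigPolyC4v}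
    (hK : K = ⟨L, fun m n => if m = L ∧ n = 0 then ε else if m = 0 ∧ n = 0 then -ε else 0⟩) : FrameOK R U N μ K := by
  set A : ℝ := 2 * (1 + (L : ℝ)) ^ 2 * ε with hA_def
  have hA0 : 0 ≤ A := by positivity
  have hDj : ∀ j ≤ 2, ∀ q : Momentum, ‖iteratedFDeriv ℝ j (frameShift K) q‖ ≤ A := fun j hj q =>
    (norm_iteratedFDeriv_frameShift_invisibleFrame_le hL hε.le hK j q).trans (weight_le hε.le hj)
  refine ⟨?_, ?_⟩
  · -- the geometric half, from `FrameGeometry A A A A (3/40)`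
    have hFG : FrameGeometry A A A A (3 / 40) μ K := by
      refine ⟨?_, ?_, ?_, ?_, ?_⟩
      · rw [frameShift_eq_neg_evalM]; exact (contDiff_evalM _).neg
      · intro p
        have h := hDj 0 (by norm_num) p
        rwa [norm_iteratedFDeriv_zero, Real.norm_eq_abs] at h
      · intro p
        have h := hDj 1 (by norm_num) p
        rwa [norm_iteratedFDeriv_one] at h
      · intro p j hj
        exact hDj j hj p
      · intro p _ t _
        have h2 := hDj 2 le_rfl p
        have hq := abs_fderiv_fderiv_le (frameShift K) p t t
        rw [← hessQuad_eq_fderiv_fderiv] at hq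
        have ht : 0 ≤ ‖t‖ * ‖t‖ := by positivity
        have := (abs_le.mp (hq.trans (by nlinarith [h2, ht] :
          ‖iteratedFDeriv ℝ 2 (frameShift K) p‖ * ‖t‖ * ‖t‖ ≤ A * ‖t‖ ^ 2))).1
        linarith
    exact geomConstants_frameLevel_covWindow hμ hFG le_rfl (by linarith) hA0 hA (by linarith) (by linarith)
  · -- the decomposition half: one piece `K'` at `n = 0`, zero pieces above
    refine ⟨fun n => if n = 0 then K else 0, fun p => ?_, fun n _ j hj q => ?_⟩
    · rw [Finset.sum_eq_single 0 (fun n _ hn => by simp [hn]) (fun h => (h (by simp)).elim)]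
      simp
    · by_cases hn : n = 0
      · subst hn
        simp only [if_true, Nat.cast_zero, mul_zero, zpow_zero, mul_one]
        have hw := (norm_iteratedFDeriv_invisibleFrame_le hL hε.le hK j q).trans (weight_le hε.le hj)
        have hu : U ^ 2 ≤ uPow j U := by
          unfold uPow
          split_ifs
          · rw [abs_of_pos hU]; nlinarith
          · exact le_rfl
        calc ‖iteratedFDeriv ℝ j (evalM K) q‖ ≤ U ^ 2 := hw.trans h4
          _ ≤ 1 * uPow j U := by rw [one_mul]; exact hu
          _ ≤ R.Gfr j * uPow j U := by gcongr; exacts [uPow_nonneg j U, hR j]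
      · simp only [hn, if_false]
        rw [evalM_zero_fun, iteratedFDeriv_fun_zero]
        simp only [Pi.zero_apply, norm_zero]
        exact mul_nonneg (mul_nonneg (by linarith [hR j]) (uPow_nonneg j U)) (zpow_nonneg (by norm_num) _)

/-- `frameDist 0 K' ≤ 2ε`. -/
theorem frameDist_zero_invisibleFrame_le {L : ℕ} (hL : L ≠ 0) {ε : ℝ} (hε : 0 ≤ ε) {K : TrigPolyC4v} (hK : K = ⟨L, fun m n => if m = L ∧ n = 0 then ε else if m = 0 ∧ n = 0 then -ε else 0⟩) :
    frameDist 0 K ≤ 2 * ε := by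
  unfold frameDist
  refine Real.iSup_le (fun p => ?_) (by positivity)
  rw [TrigPolyC4v.eval_zero, zero_sub, abs_neg]
  exact abs_invisibleFrame_eval_le hL hε hK p

/-! ## §2 The evaluation point `q⋆ = (2π/3, 0)` and the scale-`0` pieces there -/

/-- `cos(2π/3) = −1/2`. -/
private theorem cos_two_pi_div_three : Real.cos (2 * π / 3) = -1 / 2 := by
  have : 2 * π / 3 = π - π / 3 := by ring
  rw [this, Real.cos_pi_sub, Real.cos_pi_div_three]; norm_num

/-- The flat cutoff is `1` at `q⋆` (it lies on the free Fermi curve of `μ = -1`). -/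
theorem klFlatCutoffFn_qstar : klFlatCutoffFn (-1) ![2 * π / 3, 0] = 1 := by
  unfold klFlatCutoffFn freeBandFn
  simp only [Matrix.cons_val_zero, Matrix.cons_val_one, cos_two_pi_div_three, Real.cos_zero]
  rw [salmhoferCutoff_of_le] <;> norm_num

/-- `q⋆` is its own centred representative. -/
theorem centredRep_qstar : centredRep ![2 * π / 3, 0] = ![2 * π / 3, 0] := by
  funext i
  unfold centredRep
  rw [toIocMod_eq_self]
  fin_cases i <;> simp <;> constructor <;> nlinarith [Real.pi_pos]

/-- The polar angle of `q⋆` is `0`. -/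
theorem polarAngle_qstar : polarAngle ![2 * π / 3, 0] = 0 := by
  unfold polarAngle
  have : momToComplex ![2 * π / 3, 0] = ((2 * π / 3 : ℝ) : ℂ) := by
    apply Complex.ext <;> simp
  rw [this, Complex.arg_ofReal_of_nonneg (by positivity)]

/-- At `q⋆` the G-extension of any angular function returns its value at angle `0`. -/
theorem klFrameExtFn_qstar (f : ℝ → ℝ) : klFrameExtFn (-1) f ![2 * π / 3, 0] = f 0 := by
  unfold klFrameExtFn
  rw [klFlatCutoffFn_qstar, centredRep_qstar, polarAngle_qstar]
  ring

section Model

variable (L M : ℕ) [NeZero L] [NeZero M]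

/-- **The scale-`0` piece of a frame `K` at `q⋆`** = local part at angle `0` minus the frame at its own Fermi point of the ray `0`. -/
theorem klTwoLegPieceFn_zero_qstar (β U : ℝ) (K : FrameFn) :
    klTwoLegPieceFn L M β U (-1) K 0 ![2 * π / 3, 0] =
      (symInterp L (klLocSelfEnergyRe L M β U (-1) (toTrigPoly L K) 0)).eval (klFermiPointFn (-1) K 0) -
        K (klFermiPointFn (-1) K 0) := by
  rw [klTwoLegPieceFn_zero, Pi.sub_apply]
  unfold klTwoLegPolyFn klFrameProjFn
  rw [klFrameExtFn_qstar, klFrameExtFn_qstar]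
  rfl

end Model

/-- The free Fermi radius of `μ = -1` on the ray `θ = 0` is `2π/3`. -/
theorem bandFermiRadius_neg_one_zero : bandFermiRadius (-1) 0 = 2 * π / 3 := by
  symm
  refine bandFermiRadius_unique (by norm_num) (by norm_num) ⟨⟨by positivity, ?_⟩, ?_⟩
  · have := norm_dir_le_one 0
    nlinarith [Real.pi_pos]
  · rw [rayDispersion_eq]
    simp only [Real.cos_zero, Real.sin_zero, mul_one, mul_zero, cos_two_pi_div_three]
    norm_num

/-- The bare frame's Fermi point on the ray `0` is `(2π/3)·dir 0`. -/
theorem klFermiPointFn_zero_frame : klFermiPointFn (-1) (0 : FrameFn) 0 = (2 * π / 3) • dir 0 := by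
  unfold klFermiPointFn
  have : (fun p : Fin 2 → ℝ => -(0 : FrameFn) p) = 0 := by funext p; simp
  rw [this, perturbedFermiRadius_zero, bandFermiRadius_neg_one_zero]

/-- **The zero frame is admissible on the covariance window** (`FrameOK R U N μ 0` for `R.Gfr ≥ 0`, every `U`, `N`):
geometric half from `FrameGeometry 0 0 0 0 (3/40)`, decomposition half with all pieces zero. -/
theorem frameOK_zero_covWindow {R : RenConsts} (hR : ∀ j, 0 ≤ R.Gfr j) {μ : ℝ} (hμ : μ ∈ Set.Icc (-1.05 : ℝ) (-0.15))
    (U : ℝ) (N : ℕ) : FrameOK R U N μ 0 := by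
  have hs : frameShift (0 : TrigPolyC4v) = fun _ : Momentum => (0 : ℝ) := by
    funext q; simp [frameShift_eq_neg_evalM, evalM_zero_fun]
  have hDj : ∀ j, ∀ q : Momentum, ‖iteratedFDeriv ℝ j (frameShift (0 : TrigPolyC4v)) q‖ ≤ 0 := fun j q => by
    rw [hs, iteratedFDeriv_fun_zero]; simp
  refine ⟨?_, ⟨fun _ => 0, fun p => by simp [TrigPolyC4v.eval_zero], fun n _ j _ q => ?_⟩⟩
  · have hFG : FrameGeometry 0 0 0 0 (3 / 40) μ 0 := by
      refine ⟨?_, ?_, ?_, ?_, ?_⟩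
      · rw [hs]; exact contDiff_const
      · intro p
        have h := hDj 0 p
        rwa [norm_iteratedFDeriv_zero, Real.norm_eq_abs] at h
      · intro p
        have h := hDj 1 p
        rwa [norm_iteratedFDeriv_one] at h
      · intro p j _
        exact hDj j p
      · intro p _ t _
        have h2 := hDj 2 p
        have hq := abs_fderiv_fderiv_le (frameShift (0 : TrigPolyC4v)) p t t
        rw [← hessQuad_eq_fderiv_fderiv] at hq
        have ht : 0 ≤ ‖t‖ * ‖t‖ := by positivity
        have := (abs_le.mp (hq.trans (by nlinarith [h2, ht] :
          ‖iteratedFDeriv ℝ 2 (frameShift (0 : TrigPolyC4v)) p‖ * ‖t‖ * ‖t‖ ≤ 0 * ‖t‖ ^ 2))).1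
        linarith
    exact geomConstants_frameLevel_covWindow hμ hFG le_rfl (by norm_num) le_rfl (by norm_num) (by norm_num) (by norm_num)
  · rw [evalM_zero_fun, iteratedFDeriv_fun_zero]
    simp only [Pi.zero_apply, norm_zero]
    exact mul_nonneg (mul_nonneg (hR j) (uPow_nonneg j U)) (zpow_nonneg (by norm_num) _)

/-- **Order-zero Fermi-radius shift of the invisible frame** (BGM (2.40) at order zero, via the tree's `BandBounds` of the level
window `[-1.1, -0.9]`): `|u_{K'}(0) − 2π/3| ≤ 2ε/Dt_min` for `0 ≤ ε ≤ 1/40`. -/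
theorem abs_perturbedFermiRadius_invisibleFrame_sub_le (B : BandBounds (-1.1) (-0.9)) {L : ℕ} (hL : L ≠ 0) {ε : ℝ}
    (hε : 0 ≤ ε) (hε40 : 2 * ε ≤ 1 / 20) {K : TrigPolyC4v} (hK : K = ⟨L, fun m n => if m = L ∧ n = 0 then ε else if m = 0 ∧ n = 0 then -ε else 0⟩) :
    |perturbedFermiRadius (fun p => -K.eval p) (-1) 0 - 2 * π / 3| ≤ 2 * ε / B.Dtmin := by
  have hδc : Continuous fun p : Fin 2 → ℝ => -K.eval p := (K.contDiff_eval (n := 0)).continuous.neg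
  have hδ : ∀ p : Fin 2 → ℝ, (∀ i, |p i| ≤ π) → |(fun p : Fin 2 → ℝ => -K.eval p) p| ≤ 2 * ε := fun p _ => by
    simp only [abs_neg]; exact abs_invisibleFrame_eval_le hL hε hK p
  have hlo : (-1.1 : ℝ) ≤ -1 - 2 * ε := by
    have : (-1.1 : ℝ) = -1 - 1 / 10 := by norm_num
    rw [this]; linarith
  have hhi : (-1 : ℝ) + 2 * ε ≤ -0.9 := by
    have : (-0.9 : ℝ) = -1 + 1 / 10 := by norm_num
    rw [this]; linarith
  have h := abs_perturbedFermiRadius_sub_bandFermiRadius_le B hδc hδ hlo hhi 0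
  rwa [bandFermiRadius_neg_one_zero] at h

end Summit.HubbardSuperconductivity.HubbardSuperconductivity.Theorems.KLRegimeEngineV14.Negative

end
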